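import Summits.ResolutionOfSingularities.ResolutionOfSingularities.Theorems.WeightedInvariantELadderOneStage
import HarnessLib

/-!
# Stages of an e = 1 admissible sequence — the invariant `Inv'` (dimension datum, unit charts)

Route `ResolutionOfSingularities/WeightedInvariant`, door crux `HypersurfaceCentreConstruction`
(stmt-ResolutionOfSingularities-19897), e-ladder of `res-L1-w43-stub-10` (cell res-hironaka,
`D/res-D-pv-025/E1Skeleton.lean`; defs of record `Theorems/WeightedInvariantELadderOneStage.lean`, p506805).
RESHAPE of the induction invariant adopted by the line owner (res-D-pv-025 AS stub-10, STATUS 2026-08-27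
08:22Z «YES to Inv′ = (I0)∧(I1)∧(I2w)») and the registrar (res-L1-w43-plan-1 RULING gen 9 #5); requested by the
holder of `stub_e1_inv_succ` (res-type-017, RESHAPE REQUEST 07:52Z).  DEFINITIONS ONLY (objects of the line;
nothing is asserted):

* `Stage.IsUnitChart S a` — the chart `a` of the atlas carries homogeneous sections of every degree in
  `exponent • ℤʲ` that are units on `X ∩ W a` (the clause `GradedAtlas.exists_unit` guarantees on SOME chart
  through every point of `X`; finite stabilisers, read on the chart);
* `Stage.InvDim` — (I0) the hypersurface has dimension `j + 1` (`topologicalKrullDim S.X = j + 1`; the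
  dimension datum the successor step needs: it is NOT recoverable from an arbitrary stage otherwise);
* `Stage.InvReg` — (I1), verbatim the first clause of `Stage.Inv`: at every maximal point of `singImage` the
  ambient local ring is regular of dimension `2`;
* `Stage.InvOrbit` — (I2w), the second clause of `Stage.Inv` RESTRICTED TO UNIT CHARTS: on every unit chart
  through a maximal singular point its prime is homogeneous with graded-simple quotient (on a unit chart this
  follows from the dimension count, `TorusChartDim.gradedSimple_of_ringKrullDim_le`; on a non-unit chart of an
  arbitrary atlas it is not chart-locally derivable, which is why `Inv` was reshaped);
* `Stage.Inv'` — the conjunction (I0) ∧ (I1) ∧ (I2w); `Stage.inv'_of_inv` — `Inv` and (I0) give `Inv'`;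
  projections `Stage.Inv'.invDim / invReg / invOrbit`; `Stage.exists_isUnitChart` — a unit chart through every
  point of `X`.

EVIDENCE, not a claim; nothing here is a statement of H. Hironaka's manuscript.  AI-written; weaker than
expert review.
-/

noncomputable section

set_option linter.dupNamespace false -- mandated namespace of this single-conjunct summit

open CategoryTheory AlgebraicGeometry TopologicalSpace IsLocalRing
open Literature.AlgebraicGeometry.Resolution
open Summit.ResolutionOfSingularities.ResolutionOfSingularities.Theorems

namespace Summit.ResolutionOfSingularities.ResolutionOfSingularities.Theorems.ELadderOne.Stage

variable {k : Type} [Field k]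

/-- **Unit chart**: the chart `a` of the graded atlas of the stage carries, for every character
`χ : ℤʲ`, a homogeneous section of degree `exponent • χ` that is a unit on `X ∩ W a` (finite stabilisers of
the torus on the chart; `GradedAtlas.exists_unit` provides such a chart through every point of `X`).
Object of the e-ladder line; EVIDENCE, not a claim. [folklore] -/
def IsUnitChart (S : Stage k) (a : S.atlas.ι) : Prop :=
  ∀ χ : Fin S.j → ℤ, ∃ s ∈ S.atlas.piece a (S.atlas.exponent • χ), IsUnit (S.i.app (S.atlas.W a) s)

/-- **(I0) the dimension datum**: the integral hypersurface `X` of the stage has dimension `j + 1`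
(`j` = torus rank = number of blow-ups so far; rung `e = 1` starts with a curve, `j = 0`).
A predicate of the line. [folklore] -/
def InvDim (S : Stage k) : Prop :=
  topologicalKrullDim S.X = ((S.j + 1 : ℕ) : WithBot ℕ∞)

/-- **(I1)**: at every maximal point of the image of the non-regular locus the ambient local ring is regular
of dimension `2` (transversal dimension `2`).  Verbatim the first clause of `Stage.Inv`. [folklore] -/
def InvReg (S : Stage k) : Prop :=
  ∀ η ∈ S.maxSing, IsRegularLocalRing (S.Y.presheaf.stalk η) ∧
      ringKrullDim (S.Y.presheaf.stalk η) = ((2 : ℕ) : WithBot ℕ∞)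

/-- **(I2w) closed orbits on unit charts**: on every UNIT chart of the atlas through a maximal singular point
`η`, the prime of `η` is homogeneous and its quotient is graded-simple (every homogeneous section off the
prime is a unit modulo it) — the second clause of `Stage.Inv`, restricted to unit charts. [folklore] -/
def InvOrbit (S : Stage k) : Prop :=
  ∀ (a : S.atlas.ι), S.IsUnitChart a →
    ∀ (η : S.Y) (_ : η ∈ S.maxSing) (hη : η ∈ (S.atlas.W a : S.Y.Opens)),
      letI := S.atlas.gradedRing a
      (((S.atlas.W a).2.primeIdealOf ⟨η, hη⟩).asIdeal).IsHomogeneous (S.atlas.piece a) ∧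
      ∀ (d : Fin S.j → ℤ) (x : Γ(S.Y, S.atlas.W a)), x ∈ S.atlas.piece a d →
        x ∉ ((S.atlas.W a).2.primeIdealOf ⟨η, hη⟩).asIdeal →
          IsUnit (Ideal.Quotient.mk ((S.atlas.W a).2.primeIdealOf ⟨η, hη⟩).asIdeal x)

/-- **The invariant of rung `e = 1` (reshaped): `Inv' = (I0) ∧ (I1) ∧ (I2w)`.**  A predicate of the line;
EVIDENCE, not a claim. [folklore] -/
def Inv' (S : Stage k) : Prop :=
  S.InvDim ∧ S.InvReg ∧ S.InvOrbit

/-- (I0) from `Inv'`. [folklore] -/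
theorem Inv'.invDim {S : Stage k} (h : S.Inv') : S.InvDim := h.1

/-- (I1) from `Inv'`. [folklore] -/
theorem Inv'.invReg {S : Stage k} (h : S.Inv') : S.InvReg := h.2.1

/-- (I2w) from `Inv'`. [folklore] -/
theorem Inv'.invOrbit {S : Stage k} (h : S.Inv') : S.InvOrbit := h.2.2

/-- **The old invariant implies the new one, given the dimension datum**: `Inv` is (I1) ∧ (I2) with (I2) on
ALL charts, a fortiori on unit charts. [folklore] -/
theorem inv'_of_inv (S : Stage k) (h0 : S.InvDim) (h : S.Inv) : S.Inv' :=
  ⟨h0, h.1, fun a _ η hηm hη => h.2 a η hηm hη⟩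

/-- **There is a unit chart through every point of the hypersurface** (`GradedAtlas.exists_unit`).
[folklore] -/
theorem exists_isUnitChart (S : Stage k) (x : S.X) :
    ∃ a : S.atlas.ι, S.i x ∈ (S.atlas.W a : S.Y.Opens) ∧ S.IsUnitChart a := by
  obtain ⟨a, hxa, hunits⟩ := S.atlas.exists_unit x
  exact ⟨a, hxa, hunits⟩

end Summit.ResolutionOfSingularities.ResolutionOfSingularities.Theorems.ELadderOne.Stage

end
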